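import Mathlib
import HarnessLib
import Summits.HubbardSuperconductivity.HubbardSuperconductivity.Theses.KLProgramme
import Summits.HubbardSuperconductivity.HubbardSuperconductivity.Theorems.KLProgrammeKLRegimeEngineV8TowerCoreDefsC
import Summits.HubbardSuperconductivity.HubbardSuperconductivity.Theorems.KLProgrammeKLRegimeEngineV8GridLiteralsPkg
import Summits.HubbardSuperconductivity.HubbardSuperconductivity.Theorems.KLProgrammeKLRegimeEngineV8DefsU12b
import Summits.HubbardSuperconductivity.HubbardSuperconductivity.Theorems.KLProgrammeKLRegimeEngineV8IsoMomentRow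
import Summits.HubbardSuperconductivity.HubbardSuperconductivity.Theorems.KLProgrammeKLRegimeEngineScaleZeroLevelZeroFrame
import Summits.HubbardSuperconductivity.HubbardSuperconductivity.Theorems.KLProgrammeKLRegimeEngineKernelNormsWt4
import Summits.HubbardSuperconductivity.HubbardSuperconductivity.Theorems.KLProgrammeKLRegimeEngineV8DefsQ9c
import Summits.HubbardSuperconductivity.HubbardSuperconductivity.Theorems.KLProgrammeKLRegimeEngineV8DefsG11
import Summits.HubbardSuperconductivity.HubbardSuperconductivity.Theorems.KLProgrammeKLRegimeSplitFlowPieceOscDefs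
import Summits.HubbardSuperconductivity.HubbardSuperconductivity.Theorems.KLProgrammeKLRegimeTwoLegReadOscConsts

/-!
# K3 ENGINE (stmt-HubbardSuperconductivity-20437 `KLRegimeEngineV17F2`), v2 FREEZE: STUB (b) `stub_engine_step_norms` FROM ITS THREE PRODUCERS' ∃-STATEMENTS
# (the registrant's §Z-b rehearsal fe803c23cb695864 landed as a closer-modulo-producers; p1b g15, 2026-08-28; AMENDMENT 23 (α″) D-list D1 p637964 · D4 p640134 · D2‴ · D3″)

WHAT.  `stub_engine_step_norms_of_producers hexT hexI hexG : <the FROZEN stub (b) statement, verbatim after the docket renames>` — stub (b) of the v2 image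
(rev 14 8d6526fd493cf88b, FREEZE render b755cc8a5feed069, row 80e6d0ccc7e9) follows BY ROWS ONLY from exactly three producer ∃-statements (HYPOTHESES here; each is
its owner's T+ theorem):
* `hexT` — E1's (ℓ) deliverable in the (α″) shape: `∀ P R, P.WF → R.WF2 → ∃ e, IsTowerPkgC e ∧ e.1 ≤ klEngQ9cCE P R ∧ TowerCoreStepV2 klEngGeo11 P R (klEngQ8 P R) e.1 e.2.1 e.2.2`
  (…TowerCoreDefsC: atom-free core, c-slot, CE capped under token #13, history at `klEngGeo11`, (K5′) clause available; obtained e.g. from a capped levels package and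
  W3's E4 witness by `exists_towerCorePkgV2_of_levels_e4_capped klEngGeo11 klEngGeo11_wf klE4TF_le_klEngGeo11_cE4 …`);
* `hexI` — W3's class-#6 iso-moment witness `∃ (E, d, u) admissible, IsoMomFlowAt E d u` (…IsoMomentRow);
* `hexG` — the (b) conjunct-5 producer `∀ P R, P.WF → R.WF2 → ∃ e, IsGridLitPkg R e ∧ TwoLegGridMomentsStepCT P R (klEngQ7 P R) klEngGeo11 e.1 e.2.1 e.2.2` (…GridLiteralsPkg).
COMPOSITION (25 lines): `towerCoreC9_at_klEngQ9c` (c/u/CE/geo/osc joints: `klEngC₃7_le_klEngC₃6/_le_klTowerCoreCC9`, `klEngU₀12_le_klEngU₀10/_le_klTowerCoreUC9`,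
`klTowerCoreCEC9_le_klEngQ9c_CE`, `isRaiseOf_klEngQ9c_klEngQ8`) ⇒ conjunct 2 at `j ≥ 1` and conjunct 3; `levelZero_norms_frame_of_isRaiseOf_U10L4` at `K_n` ⇒ level `j = 0`;
`kernelNormsV4_of_kernelNormsWt4_klWtBudget` at `j = n` ⇒ conjunct 1; `isoFirstMomentsAt_flow_klIsoMomPack … klEngGeo11 … (klEngQ9c P R) …` ⇒ conjunct 4;
`twoLegGridFlowMomentsAtC_klZ_of_exists` ⇒ conjunct 5.  The day the three producers land, stub (b) closes by `stub_engine_step_norms_of_producers thmT thmI thmG`.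
A composition of landed rows; nothing about the model is asserted beyond its hypotheses; nothing asserts (b), (ℓ), any stub of 20437, K3 or superconductivity.
-/

noncomputable section

namespace Summit.HubbardSuperconductivity.HubbardSuperconductivity.Theorems.EngineV8

set_option linter.dupNamespace false -- summit = problem name (single-conjunct summit), D-0017

open Real Finset Literature.MathematicalPhysics.QuantumLattice Literature.Probability.LatticeModels
open Summit.HubbardSuperconductivity.HubbardSuperconductivity.Theorems.KLRegimeSplit
open Summit.HubbardSuperconductivity.HubbardSuperconductivity.Theorems.KLProgrammeLegKernels
open Summit.HubbardSuperconductivity.HubbardSuperconductivity.Theorems.DispersionFlow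

/-- **STUB (b) FROM ITS THREE PRODUCERS' ∃-STATEMENTS** (the FROZEN v2 text of `stub_engine_step_norms`, verbatim after the docket renames, as the conclusion). -/
theorem stub_engine_step_norms_of_producers
    (hexT : ∀ (P : SplitConsts) (R : RenConsts), P.WF → R.WF2 →
      ∃ e : ℝ × (EngConsts → ℝ → ℝ) × ℝ, IsTowerPkgC e ∧ e.1 ≤ klEngQ9cCE P R ∧ TowerCoreStepV2 klEngGeo11 P R (klEngQ8 P R) e.1 e.2.1 e.2.2)
    (hexI : ∃ Edu : ℝ × (SplitConsts → RenConsts → ℝ) × (GeoConsts → SplitConsts → RenConsts → EngConsts → ℝ → ℝ),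
      0 ≤ Edu.1 ∧ (∀ P R, 0 ≤ Edu.2.1 P R) ∧ (∀ G P R Q cc, 0 < Edu.2.2 G P R Q cc) ∧ IsoMomFlowAt Edu.1 Edu.2.1 Edu.2.2)
    (hexG : ∀ (P : SplitConsts) (R : RenConsts), P.WF → R.WF2 →
      ∃ e : (ℝ × ℝ × ℝ) × (EngConsts → ℝ → ℝ) × ℝ, IsGridLitPkg R e ∧ TwoLegGridMomentsStepCT P R (klEngQ7 P R) klEngGeo11 e.1 e.2.1 e.2.2) :
    ∀ (P : SplitConsts) (R : RenConsts) (c : ℝ), P.WF → R.WF2 → 0 < c → c ≤ klEngC₃7 P R →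
      ∀ μ ∈ klWindowC, ∀ U : ℝ, 0 < U → U ≤ klEngU₀12 P R c → ∀ β : ℝ, klBetaMin ≤ β → β ≤ Real.exp (c / U ^ 2) →
        ∀ (L M : ℕ) [NeZero L] [NeZero M], klEngL₄ P R β U ≤ L → klEngM₃ β U L ≤ M →
          ∀ n : ℕ, 1 ≤ n → n ≤ nScales β + 1 → IsKLRegime U c (-(n : ℤ)) →
            HistP klPredsV17F2 L M klEngGeo11 P (klEngQ9c P R) R β U μ 0 n →
              (∀ m, 1 ≤ m → m < n → FlowPieceOscAt L M (klReadOscC P R) β U μ m) →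
              FrameOK R U (nScales β) μ (klFlowFrameU L M β U μ n) →
                (∀ j ≤ n, LevelsUExportMixedAt L M (klCU2 P R (klEngQ7 P R)) P β U μ j) →
                  KernelNormsV4 L M P (klEngQ9c P R) β U μ (klFlowFrameU L M β U μ n) n ∧
                    (∀ j ≤ n, (KernelNormsLevels L M P (klEngQ9c P R) β U μ (klFlowFrameU L M β U μ n) j ∧
                      KernelNormsWt4 L M (klWtBudget P (klEngQ9c P R) U j) β U μ (klFlowFrameU L M β U μ n) j)) ∧
                    EngineFirstMoments L M klEngGeo11 P (klEngQ9c P R) β U μ (klFlowFrameU L M β U μ n) n ∧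
                    IsoFirstMomentsAt L M klIsoMomC (klIsoMomD P R) P β U μ n ∧
                    TwoLegGridFlowMomentsAtC L M (klZt P R) (klZs1 P R) (klZs2 P R) c β U μ n := by
  intro P R c hP hR hc hc3 μ hμ U hU hUle β hβ hβc L M _ _ hL hM n hn1 hn hreg hhist hosc hfr hlevU
  have hc36 : c ≤ klEngC₃6 P R := hc3.trans (klEngC₃7_le_klEngC₃6 P R)
  have hU10 : U ≤ klEngU₀10 P R c := hUle.trans (klEngU₀12_le_klEngU₀10 P R c)
  have hβ0 : 0 ≤ β := le_trans (by norm_num [klBetaMin]) hβ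
  -- tower core at the frozen tokens: levels `1 ≤ j ≤ n` and first moments (…TowerCoreDefsC §4)
  obtain ⟨hlev1, hE4⟩ := towerCoreC9_at_klEngQ9c (hexT P R hP hR) hc hc36 (hc3.trans (klEngC₃7_le_klTowerCoreCC9 P R)) hμ hU hU10
    (hUle.trans (klEngU₀12_le_klTowerCoreUC9 P R c)) hβ hβc hL hM hn1 hn hreg hhist hosc hfr hlevU
  -- level `j = 0` at `K_n` from the scale-0 rung, conjunct 1 from the weighted bundle at `j = n`
  have h0 := levelZero_norms_frame_of_isRaiseOf_U10L4 P R (klEngQ9c P R) (isRaiseOf_klEngQ9c P R) c hP hR hc hc36 μ hμ U hU hU10 β hβ hβc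
    (klFlowFrameU L M β U μ n) hfr L M hL hM
  have hlev : ∀ j ≤ n, KernelNormsLevels L M P (klEngQ9c P R) β U μ (klFlowFrameU L M β U μ n) j ∧
      KernelNormsWt4 L M (klWtBudget P (klEngQ9c P R) U j) β U μ (klFlowFrameU L M β U μ n) j := by
    intro j hj
    rcases Nat.eq_zero_or_pos j with rfl | hj1
    · exact ⟨h0.2.1, h0.2.2⟩
    · exact hlev1 j hj1 hj
  have hV4 : KernelNormsV4 L M P (klEngQ9c P R) β U μ (klFlowFrameU L M β U μ n) n :=
    kernelNormsV4_of_kernelNormsWt4_klWtBudget hβ0 (hlev n le_rfl).2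
  -- conjunct 4: the iso-moment row from W3's witness through the deferred package
  obtain ⟨⟨E, d, u⟩, hE0, hd, hu, hE⟩ := hexI
  have hiso := isoFirstMomentsAt_flow_klIsoMomPack hE0 hd hu hE klEngGeo11 klEngGeo11_wf P R (klEngQ9c P R) c hP hR (klEngQ9c_wf P R) hc hc36 μ hμ
    U hU (hUle.trans (klEngU₀12_le_klIsoMomU P R c)) β hβ hβc L M hL hM n hn1 hn hreg hhist hfr
  -- conjunct 5: the grid C-atom from the deferred grid-literal producer
  have hgrid := twoLegGridFlowMomentsAtC_klZ_of_exists (hexG P R hP hR) (isRaiseOf_klEngQ9c P R) hc hc36 (hc3.trans (klEngC₃7_le_klGridLitCAt P R)) hμ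
    hU hU10 (hUle.trans (klEngU₀12_le_klGridLitUAt P R c)) hβ hβc hL hM hn1 hn hhist hfr hV4 hlev hlevU
  exact ⟨hV4, hlev, hE4, hiso, hgrid⟩

end Summit.HubbardSuperconductivity.HubbardSuperconductivity.Theorems.EngineV8

end
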